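import Summits.BirchSwinnertonDyer.BirchSwinnertonDyer.Theses.SignedBaseChange
import Summits.BirchSwinnertonDyer.BirchSwinnertonDyer.Theorems.SignedBaseChangeAnticyclotomicEisensteinDivisibilityCoprimeClassNumberMult
import HarnessLib

/-! # Skeleton `bdpline_coprime` — the line `bdpline` FOR THE RESTATED CRUX (binder `¬ p ∣ h_K`), READY FOR REGISTRATION
**v6 (lead bsd-line-sbc-p1 gen 7, 2026-08-28)**: research stub = `Lines/bdpline.lean` v33 `stub_signedEisensteinSS_mult` (Form T narrowed a second
time: extra binder `¬ (∀ ℓ prime, ℓ ∣ N → ℓ² ∣ N)` — some prime divides `N` exactly once); composition = the lead's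
`SignedBaseChangeAcDivCoprimeClassNumberMult.anticyclotomicEisensteinDivisibility_coprime_of_stubs_mult`, typed against the v32/v33 named-facts
text VERBATIM (no in-file adapter: `nswSS` / `namedFactsSS_v30` dropped). Stubs (2): stub_namedFactsSS · stub_signedEisensteinSS_mult. HISTORY:
(lead bsd-line-sbc-p1 gen 5, 2026-08-28; v2–v5 by gen 6 — v5: stub_namedFactsSS = `Lines/bdpline.lean` v32 text (Greenberg 2006 Props. 4.1/4.2 replaced by Tate's global
Euler characteristic + Poitou–Tate 17.13 (a) resp. discharged; NSW (8.3.20) derived in-file as `nswSS`, w2 g9 p654899); in-file adapter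
`namedFactsSS_v30` feeds p650754). NOT a line of the registered crux stmt-BirchSwinnertonDyer-20727 (whose text has no
class-number binder; its skeleton of record is `Lines/bdpline.lean` v32): this workfile is the TWO-stub skeleton the line becomes IF the planner
restates the crux with `¬ p ∣ NumberField.classNumber K →` inserted after `κ₂.IsAnticyclotomic →` (the conclusion `Coprime` below is that
restated text BY VALUE but for the by-name antecedent `SignedTwoVariableInputs`, δ-equal). **v3**: composition = the width seat
bsd-line-sbc-p1-w7's `SignedBaseChangeAcDivCoprimeClassNumberLive.anticyclotomicEisensteinDivisibility_coprime_of_stubs_live` (p650754, a copy of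
p642307 fed by the v29 fact list and the NARROWED Form T); stubs (2): `stub_namedFactsSS` (= `Lines/bdpline.lean` v29/v30 text: YZ26 ×3 · LV19 ·
CW24 ×3 · BLV26∘CW24 (flag) · Greenberg 2016 4.1.1 + Greenberg 2006 4.1/4.2 + NSW (8.3.20) · BSTW24 6.27(i) PRE · BCS25 4.2.2 · CHKLL25 7.1/7.2) ·
`stub_signedEisensteinSS_live` (RESEARCH, Form T OFF the semistable-ramified cell; text = v30's). The parent K1″ stays derivable:
`SignedBaseChangeK1AcanchorCoprimeClassNumber.twistPairGreenbergProductDivisibilityCanonical_of_acanchorChildren_coprimeClassNumber` (p643340) with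
the `∃`-half FD‴ (p642494) GRANTED the refereed fact `QuadraticFields.BRR2022_thm_1`. Research content: Form T on {p ∤ h_K} × {W non-semistable
with some q ∥ N, or some q ∥ N with p ∣ ord_q(Δ_W)}; K1 (BLV Step 4 unsourced, flag `BLV-step4-UNSOURCED-on-R4`) on the all-additive cell inside
the BLV conjunct. -/

-- D-0017: single-problem summit, the namespace repeats the problem name by design.
set_option linter.dupNamespace false
set_option autoImplicit false

noncomputable section

open scoped Classical

namespace Summit.BirchSwinnertonDyer.BirchSwinnertonDyer.Cruxes.AnticyclotomicEisensteinDivisibility.BdplineCoprime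

open Summit.BirchSwinnertonDyer.BirchSwinnertonDyer.Theses.SignedBaseChange
open Literature.NumberTheory.EllipticCurves
open Summit.BirchSwinnertonDyer.BirchSwinnertonDyer.Theorems

/-- The RESTATED crux text (binder `¬ p ∣ h_K` after `κ₂.IsAnticyclotomic →`), by-name antecedent. -/
def Coprime : Prop :=
  SignedTwoVariableInputs → Literature.NumberTheory.EllipticCurves.ModularForms.nonempty_modularParametrizationData → ∀ (W : WeierstrassCurve ℚ) [W.IsElliptic] [W.IsGloballyMinimal] (p : ℕ) [Fact p.Prime], 5 ≤ p → W.HasGoodReductionAtPrime p → Literature.NumberTheory.EllipticCurves.Rank1Residual.Surj W p → ∀ (K : Type) [Field K] [NumberField K] (ι : PadicAlgCl p ≃+* ℂ) (v vbar : IsDedekindDomain.HeightOneSpectrum (NumberField.RingOfIntegers K)) (κ₁ κ₂ : Literature.NumberTheory.EllipticCurves.ZpExtension K p) (γ₁ γ₂ : Field.absoluteGaloisGroup K) [Fact (Literature.NumberTheory.EllipticCurves.ZpExtension.IsTopGeneratorPair κ₁ κ₂ γ₁ γ₂)] [NeZero (NumberField.discr K).natAbs] (N : ℕ) [NeZero N]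 (f : CuspForm (CongruenceSubgroup.Gamma0 N) 2), Literature.NumberTheory.EllipticCurves.ModularForms.IsNewformOf W f → (N : ℤ) = W.conductorNorm ℤ → Literature.NumberTheory.EllipticCurves.IsImaginaryQuadratic K → ((Ideal.span {(p : ℤ)}).primesOver (NumberField.RingOfIntegers K)).ncard = 2 → ((p : ℕ) : NumberField.RingOfIntegers K) ∈ v.asIdeal → ((p : ℕ) : NumberField.RingOfIntegers K) ∈ vbar.asIdeal → vbar ≠ v → (∀ (w : NumberField.InfinitePlace K) (k : NumberField.RingOfIntegers K), k ∈ v.asIdeal ↔ ‖ι.symm (w.embedding (k : K))‖ < 1) → IsCoprime (N : ℤ) (NumberField.discr K) → (∀ ℓ : ℕ, ℓ.Prime → ℓ ∣ N → ((Ideal.span {(ℓ : ℤ)}).primesOver (NumberField.RingOfIntegers K)).ncard = 2) → Odd (NumberField.discr K) → NumberField.discr K ≠ -3 → κ₁.IsCyclotomic → κ₂.IsAnticyclotomic → ¬ p ∣ NumberField.classNumber K → ∀ (Ω δ : ℂ) (Ωp : (Literature.NumberTheory.EllipticCurves.unrIntegers p)ˣ) (LK G : PowerSeries (PowerSeries (PadicComplexInt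 p))), Ω ≠ 0 → (δ ^ 2 = (NumberField.discr K : ℂ) ∨ δ ^ 2 = -(NumberField.discr K : ℂ)) → Literature.NumberTheory.EllipticCurves.IsKatzMeasure₂ ι v vbar ∅ κ₁ κ₂ γ₁⁻¹ γ₂⁻¹ 1 Ω δ ((Ωp : Literature.NumberTheory.EllipticCurves.unrIntegers p) : PadicComplex p) LK → Literature.NumberTheory.EllipticCurves.IsGreenbergLFunctionAnyRoot₂ ι v vbar κ₁ κ₂ γ₁⁻¹ γ₂⁻¹ f (NumberField.discr K).natAbs (NumberField.classNumber K) LK G → ∀ J : ℤ_[p] →+* PadicComplexInt p, (∀ x : ℤ_[p], ((J x : PadicComplexInt p) : PadicComplex p) = ((x : ℚ_[p]) : PadicComplex p)) → ((WeierstrassCurve.XGr₂.charIdeal (W.baseChange K) p κ₁ κ₂ vbar γ₁ γ₂).map (Literature.NumberTheory.EllipticCurves.IwasawaAlgebra₂.toUnr₂ p J)).map (PowerSeries.constantCoeff (R := PowerSeries (PadicComplexInt p))) ≤ Ideal.span {Literature.NumberTheory.EllipticCurves.UnrSeries₂.minus G}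

/-- stub FACTS (= `Lines/bdpline.lean` v32 `stub_namedFactsSS`, text verbatim). -/
theorem stub_namedFactsSS :
    (Literature.NumberTheory.EllipticCurves.YanZhu2026.thm42_XGr₂_isTorsion_charIdeal_le_greenbergAnyRoot ∧
      Literature.NumberTheory.EllipticCurves.YanZhu2026.thm47_ord_localised_iff_greenbergAnyRoot_localised_guarded ∧
      Literature.NumberTheory.EllipticCurves.YanZhu2026.thm33_exists_isHidaRankinLFunction) ∧
    (∀ (W : WeierstrassCurve ℚ) [W.IsGloballyMinimal] (K : Type) [Field K] [NumberField K] (p : ℕ) [Fact p.Prime]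
      (κ : Literature.NumberTheory.EllipticCurves.ZpExtension K p) (𝔭 𝔭' : IsDedekindDomain.HeightOneSpectrum (NumberField.RingOfIntegers K)),
      Literature.NumberTheory.EllipticCurves.AcSigned.longoVigni2019_thm14_signedSelmerDual_rank_one W K p κ 𝔭 𝔭') ∧
    (∀ (N : ℕ) [NeZero N] (W : WeierstrassCurve ℚ) [W.IsGloballyMinimal] (K : Type) [Field K] [NumberField K] (p : ℕ) [Fact p.Prime]
      (κ : Literature.NumberTheory.EllipticCurves.ZpExtension K p) (𝔭 𝔭' : IsDedekindDomain.HeightOneSpectrum (NumberField.RingOfIntegers K)),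
      Literature.NumberTheory.EllipticCurves.AcSigned.castellaWan2024_proofThm68_transferInputs N W K p κ 𝔭 𝔭') ∧
    (∀ (N : ℕ) [NeZero N] (W : WeierstrassCurve ℚ) [W.IsGloballyMinimal] (K : Type) [Field K] [NumberField K] (p : ℕ) [Fact p.Prime]
      (κ : Literature.NumberTheory.EllipticCurves.ZpExtension K p) (𝔭 𝔭' : IsDedekindDomain.HeightOneSpectrum (NumberField.RingOfIntegers K)),
      Literature.NumberTheory.EllipticCurves.AcSigned.castellaWan2024_lemma67_finrank_torsionCharIdeal N W K p κ 𝔭 𝔭') ∧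
    (∀ (N : ℕ) [NeZero N] (W : WeierstrassCurve ℚ) [W.IsGloballyMinimal] (K : Type) [Field K] [NumberField K] (p : ℕ) [Fact p.Prime]
      (κ : Literature.NumberTheory.EllipticCurves.ZpExtension K p) (𝔭 𝔭' : IsDedekindDomain.HeightOneSpectrum (NumberField.RingOfIntegers K)),
      Literature.NumberTheory.EllipticCurves.AcSigned.castellaWan2024_proofThm68_selmerRel_le_selmerSgn N W K p κ 𝔭 𝔭') ∧
    Literature.NumberTheory.EllipticCurves.BertoliniLongoVenerucci2026.thmA_castellaWan_thm68_exists_isCWBDPLFunction_charIdeal_map_le_rat ∧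
    (Literature.NumberTheory.IwasawaTheory.Greenberg2016.prop411_selmer_isAlmostDivisible ∧
      (∀ (K : Type) [Field K] [NumberField K], Literature.NumberTheory.GaloisCohomology.tateGlobalEulerPoincareCharacteristic K) ∧
      (∀ (K : Type) [Field K] [NumberField K], Literature.NumberTheory.GaloisCohomology.poitouTate_restricted_three_le K)) ∧
    Literature.NumberTheory.EllipticCurves.BurungaleSkinnerTianWan2024.prop627_span_minus_eq_span_bdp_supersingular_PRE ∧
    Literature.NumberTheory.EllipticCurves.BurungaleCastellaSkinner2025.prop422_exists_isBDPLFunction_mu_eq_zero ∧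
    Literature.NumberTheory.EllipticCurves.CastellaHsuKunduLeeLiu2025.thm71_cor72_exists_isCWBDPLFunction_charIdeal_map_le_rat := by
  sorry

/-- stub S1⁻-mult (RESEARCH; = `Lines/bdpline.lean` v33 `stub_signedEisensteinSS_mult`, text verbatim: Form T with `¬ p ∣ h_K`, OFF the
semistable-ramified cell and OFF the all-additive cell). -/
theorem stub_signedEisensteinSS_mult :
    SignedTwoVariableInputs → Literature.NumberTheory.EllipticCurves.ModularForms.nonempty_modularParametrizationData → ∀ (W : WeierstrassCurve ℚ) [W.IsElliptic] [W.IsGloballyMinimal] (p : ℕ) [Fact p.Prime], 5 ≤ p → W.HasGoodReductionAtPrime p → W.frobeniusTrace p = 0 → Literature.NumberTheory.EllipticCurves.Rank1Residual.Surj W p → ∀ (K : Type) [Field K] [NumberField K] (ι : PadicAlgCl p ≃+* ℂ) (v vbar : IsDedekindDomain.HeightOneSpectrum (NumberField.RingOfIntegers K)) (κ₁ κ₂ : Literature.NumberTheory.EllipticCurves.ZpExtension K p) (γ₁ γ₂ : Field.absoluteGaloisGroup K) [Fact (Literature.NumberTheory.EllipticCurves.ZpExtension.IsTopGeneratorPair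 κ₁ κ₂ γ₁ γ₂)] [NeZero (NumberField.discr K).natAbs] (N : ℕ) [NeZero N] (f : CuspForm (CongruenceSubgroup.Gamma0 N) 2), Literature.NumberTheory.EllipticCurves.ModularForms.IsNewformOf W f → (N : ℤ) = W.conductorNorm ℤ → Literature.NumberTheory.EllipticCurves.IsImaginaryQuadratic K → ¬ p ∣ NumberField.classNumber K → ¬ (Squarefree N ∧ ∀ q : ℕ, q.Prime → q ∣ N → ∃ v' : IsDedekindDomain.HeightOneSpectrum (NumberField.RingOfIntegers ℚ), ((q : ℕ) : NumberField.RingOfIntegers ℚ) ∈ v'.asIdeal ∧ ∃ 𝔓 ∈ v'.primesAbove, ∃ σ ∈ 𝔓.inertia (Field.absoluteGaloisGroup ℚ), ∃ P : W.geomTorsion (p : ℤ), σ • P ≠ P) → ¬ (∀ ℓ : ℕ, ℓ.Prime → ℓ ∣ N → ℓ ^ 2 ∣ N) → ((Ideal.span {(p : ℤ)}).primesOver (NumberField.RingOfIntegers K)).ncard = 2 → ((p : ℕ) : NumberField.RingOfIntegers K) ∈ v.asIdeal → ((p : ℕ) : NumberField.RingOfIntegers K) ∈ vbar.asIdeal →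 vbar ≠ v → (∀ (w : NumberField.InfinitePlace K) (k : NumberField.RingOfIntegers K), k ∈ v.asIdeal ↔ ‖ι.symm (w.embedding (k : K))‖ < 1) → IsCoprime (N : ℤ) (NumberField.discr K) → (∀ ℓ : ℕ, ℓ.Prime → ℓ ∣ N → ((Ideal.span {(ℓ : ℤ)}).primesOver (NumberField.RingOfIntegers K)).ncard = 2) → Odd (NumberField.discr K) → NumberField.discr K ≠ -3 → κ₁.IsCyclotomic → κ₂.IsAnticyclotomic → ∀ (h𝔭 : AcSigned.IsNonsplitIn κ₂ v) (γ𝔭 : Field.absoluteGaloisGroup (v.adicCompletion K)) (hγ𝔭 : κ₂ (resGalOfEmb (closureEmb (K := K) (v.adicCompletion K)) γ𝔭) = κ₂ γ₂) (hne : v ≠ vbar) (hvp : ((p : ℕ) : NumberField.RingOfIntegers K) ∈ v.asIdeal) (ΩK : ℂ) (Ωp : (unrIntegers p)ˣ) (L : UnrSeries p) (z : AcSigned.selmerLambdaAdic (W.baseChange K) p κ₂ γ₂ (fun _ ↦ .sgn 1)), ΩK ≠ 0 → CastellaWan2024.IsCWBDPLFunction ι v κ₂ γ₂ f (NumberField.discr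 K) ΩK ((Ωp : unrIntegers p) : PadicComplex p) L → AcSigned.TransferInputs (W.baseChange K) p κ₂ γ₂ (YanZhu2026.isTopGenerator_of_pair (κ₁ := κ₁) (γ₁ := γ₁) : κ₂.IsTopGenerator γ₂) v h𝔭 γ𝔭 hγ𝔭 vbar hne hvp 1 z L → ∃ k : ℕ, Ideal.span {((p : ℕ) : IwasawaAlgebra p) ^ k} * AcSigned.X.torsionCharIdeal (W.baseChange K) p κ₂ ∅ (fun _ ↦ .sgn 1) (YanZhu2026.isTopGenerator_of_pair (κ₁ := κ₁) (γ₁ := γ₁) : κ₂.IsTopGenerator γ₂) ≤ (AcSigned.signedHeegnerCharIdeal (YanZhu2026.isTopGenerator_of_pair (κ₁ := κ₁) (γ₁ := γ₁) : κ₂.IsTopGenerator γ₂) 1 z).map (IwasawaAlgebra.invol p) ^ 2 := by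
  sorry

/-- **The restated crux from the two stubs** (v6: the lead gen 7's `…CoprimeClassNumberMult…_of_stubs_mult`, fed `stub_namedFactsSS`
directly; twice-narrowed Form T). -/
theorem Coprime_of : Coprime :=
  SignedBaseChangeAcDivCoprimeClassNumberMult.anticyclotomicEisensteinDivisibility_coprime_of_stubs_mult stub_namedFactsSS
    stub_signedEisensteinSS_mult

end Summit.BirchSwinnertonDyer.BirchSwinnertonDyer.Cruxes.AnticyclotomicEisensteinDivisibility.BdplineCoprime

end
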